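import Mathlib

/-!
# The calculus input of Freedman's inequality

For `|d| ≤ b`, `λ ≥ 0` one has `e^{λd} ≤ 1 + λd + d² · (e^{λb} − 1 − λb)/b²`
(Freedman 1975, (4.1); Bennett 1962).  Proof by termwise comparison of the exponential
series: writing `eˣ = 1 + x + x² · S x` with `S x = ∑ₙ xⁿ/(n+2)!`, the series `S` is
monotone in `|x|`, so `S (λd) ≤ S (λb)`, and `(λd)² · S (λb) = d² (e^{λb} − 1 − λb)/b²`.
-/

namespace Summit.MatrixMultiplication.MatrixMultiplication.Theorems

open scoped Nat

/-- Summability of the twice-shifted exponential series `∑ₙ xⁿ/(n+2)!`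
(comparison with `∑ₙ |x|ⁿ/n!`). -/
private lemma summable_expTail₂ (x : ℝ) :
    Summable (fun n : ℕ => x ^ n / ((n + 2)! : ℝ)) := by
  refine Summable.of_norm_bounded (Real.summable_pow_div_factorial |x|) (fun n => ?_)
  have h1 : (0 : ℝ) < (n ! : ℝ) := by exact_mod_cast Nat.factorial_pos n
  have h2 : (n ! : ℝ) ≤ ((n + 2)! : ℝ) := by exact_mod_cast Nat.factorial_le (by omega)
  calc ‖x ^ n / ((n + 2)! : ℝ)‖ = |x| ^ n / ((n + 2)! : ℝ) := by
        rw [Real.norm_eq_abs, abs_div, abs_pow, Nat.abs_cast]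
    _ ≤ |x| ^ n / (n ! : ℝ) := div_le_div_of_nonneg_left (pow_nonneg (abs_nonneg x) n) h1 h2

/-- Splitting the first two terms off the exponential series:
`eˣ = 1 + x + x² · ∑ₙ xⁿ/(n+2)!`. -/
private lemma exp_eq_expTail₂ (x : ℝ) :
    Real.exp x = 1 + x + x ^ 2 * ∑' n : ℕ, x ^ n / ((n + 2)! : ℝ) := by
  have h1 : HasSum (fun n : ℕ => x ^ n / (n ! : ℝ)) (Real.exp x) := by
    rw [Real.exp_eq_exp_ℝ]
    exact NormedSpace.expSeries_div_hasSum_exp x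
  have h2 := (hasSum_nat_add_iff' 2).mpr h1
  have h3 : HasSum (fun n : ℕ => x ^ (n + 2) / ((n + 2)! : ℝ))
      (x ^ 2 * ∑' n : ℕ, x ^ n / ((n + 2)! : ℝ)) := by
    have hf : (fun n : ℕ => x ^ (n + 2) / ((n + 2)! : ℝ)) =
        (fun n : ℕ => x ^ 2 * (x ^ n / ((n + 2)! : ℝ))) := by
      funext n
      ring
    rw [hf]
    exact (summable_expTail₂ x).hasSum.mul_left (x ^ 2)
  have h4 := h2.unique h3
  have hs : ∑ i ∈ Finset.range 2, x ^ i / (i ! : ℝ) = 1 + x := by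
    simp [Finset.sum_range_succ]
  rw [hs] at h4
  linarith

/-- Monotonicity of the twice-shifted exponential series in `|x|`:
`∑ₙ tⁿ/(n+2)! ≤ ∑ₙ cⁿ/(n+2)!` for `|t| ≤ c`. -/
private lemma expTail₂_mono {t c : ℝ} (h : |t| ≤ c) :
    ∑' n : ℕ, t ^ n / ((n + 2)! : ℝ) ≤ ∑' n : ℕ, c ^ n / ((n + 2)! : ℝ) := by
  refine (summable_expTail₂ t).tsum_le_tsum (fun n => ?_) (summable_expTail₂ c)
  have hn : t ^ n ≤ c ^ n :=
    calc t ^ n ≤ |t| ^ n := by rw [← abs_pow]; exact le_abs_self _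
      _ ≤ c ^ n := pow_le_pow_left₀ (abs_nonneg t) h n
  have hpos : (0 : ℝ) < ((n + 2)! : ℝ) := by exact_mod_cast Nat.factorial_pos _
  exact div_le_div_of_nonneg_right hn hpos.le

set_option linter.dupNamespace false in
/-- The calculus input of Freedman's / Bennett's inequality: for `|d| ≤ b` and `λ ≥ 0`,
`e^{λd} ≤ 1 + λd + d²·(e^{λb} − 1 − λb)/b²` (termwise comparison of the exponential series).
[Freedman 1975, (4.1); Bennett 1962] -/
theorem stub_exp_le_quad : ∀ (b lam d : ℝ), 0 < b → 0 ≤ lam → |d| ≤ b →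
    Real.exp (lam * d) ≤ 1 + lam * d + d ^ 2 * ((Real.exp (lam * b) - 1 - lam * b) / b ^ 2) := by
  intro b lam d hb hlam hd
  have habs : |lam * d| ≤ lam * b := by
    rw [abs_mul, abs_of_nonneg hlam]
    exact mul_le_mul_of_nonneg_left hd hlam
  have key := expTail₂_mono habs
  have hE : d ^ 2 * ((Real.exp (lam * b) - 1 - lam * b) / b ^ 2) =
      (lam * d) ^ 2 * ∑' n : ℕ, (lam * b) ^ n / ((n + 2)! : ℝ) := by
    rw [exp_eq_expTail₂ (lam * b)]
    field_simp
    ring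
  rw [hE, exp_eq_expTail₂ (lam * d)]
  have hsq : 0 ≤ (lam * d) ^ 2 := sq_nonneg _
  nlinarith [mul_le_mul_of_nonneg_left key hsq]

end Summit.MatrixMultiplication.MatrixMultiplication.Theorems
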